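import Mathlib
import Summits.NavierStokesRegularity.NavierStokesRegularity.Theorems.BarrierStepRungThreeBarrierSoundnessRegionThree
import HarnessLib

/-!
# `BarrierSoundness`, REPAIRED FORM K2″ — per-coordinate window caps (route `BarrierStepRungThree`, item
  stmt-NavierStokesRegularity-23421): a barrier/clock certificate with one-directional tail
  bookkeeping is SOUND — every `(η, η)`-pseudo-flow from the description steps

The item `BarrierSoundness` as typed (rev 2 of the route) is misstated: its description `P` and its
REGION book the outside energies PER SHELL over infinitely many shells with a two-sided TAIL RATE
clause, and along a `PseudoFlowOn` such caps can fail "from infinity" (see the evidence note on the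
item). The theorem `barrierSoundness₃` below (the variant of `barrierSoundness₂` with caps `Φ i j` and properness bounds `Mw i j` indexed by mode and shell, and the base link asked only at the top window shell) is the ∀-side for the REPAIRED certificate format
proposed there, which differs from the typed one only in the tail bookkeeping:

* the description `P′` books the energies ABOVE the window by TAIL SUMS (`∑_{j≥k}∑_i F_{i,j} ≤ r_k²/2`,
  all partial sums) and remembers that only FINITELY many shells below the window are charged
  (`∃ D, S = F = 0` at every shell `k` with `k + D < kLo`; Tao's (4.11));
* the profile obeys the explicit one-directional recursion
  `2^{5(k-1)/2} (∑|α_{·,(0,0,1)}|) q_{k-1}² ≤ ρ_k`, the base link `2Φ_j ≤ q_{kLo+j}²` and the re-entry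
  decay `q_{k+1} ≤ 2^{-θ} r_k` above the window; TAIL RATE and the GOAL's outside conjunct are asked
  only BELOW the window.

PROOF (Prajna–Rantzer eventuality, made restart-compatible): base — the datum lies in `P′`; step —
(i) the empty block of low shells stays empty (tools II-a); (ii) FIRST-EXIT BOOTSTRAP by real induction
on the closed constraints {`v ∘ win ≤ 0`, window caps `Φ`, caps `q²/2` at the finitely many charged
shells below}: on an initial segment where they hold the upper tail is capped by the one-directional
induction (tools II-b/III), the true state is a REGION state, the clauses give the clock rate `≤ -γ`
and the energy rates below, whence STRICT margins and propagation; (iii) CLOCK `v(win S(s)) ≤ -γ s`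
and the floor `v > -γ c` force a first goal time `τ₁ ∈ (0, c]`; (iv) GOAL at the true state gives
`a := |S_{i₀,1}(τ₁)| ≥ 2^{-θ}` and `P′` at the shifted rescaled state (tails re-enter by
`q_{k+1} ≤ 2^{-θ} r_k ≤ a r_k` and `D ↦ D+1`; boundedness by (4.5); envelope by `Φ, q²/2 ≤ env`).

HONEST FRAMING: this is the ∀-side (soundness) of a certificate FORMAT for Tao-type MODEL lattice
pseudo-flows at the dyadic scale ratio; it proves nothing about any table (the ∃-side, a certificate for
some comparable table, is the route's other crux) and nothing about the Navier–Stokes equations; the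
route's rung leaf (`TaoLadderRungThree.Target`, TL-M3) is not the summit Statement. The statement of
`barrierSoundness₃` is the RECOMMENDED re-typing of item 23421 (it specialises to `barrierSoundness₂` with `Φ i j := Φ j`, `Mw i j := M`).
-/

noncomputable section

-- the sub-problem namespace `Summit.NavierStokesRegularity.NavierStokesRegularity` repeats the summit name by design (D-0017)
set_option linter.dupNamespace false

namespace Summit.NavierStokesRegularity.NavierStokesRegularity.Theorems

namespace BarrierSoundness

open Set MeasureTheory intervalIntegral Filter Topology
open Literature.Analysis.FluidPDE Literature.Analysis.FluidPDE.TaoCascade GappedFrontRobust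

/-- **`BarrierSoundness`, repaired form K2″ with per-coordinate caps (recommended re-typing of item
stmt-NavierStokesRegularity-23421).** For ALL data of a barrier/clock certificate with
one-directional tail bookkeeping (window clauses exactly as in route `BarrierStepRungThree`; tail
sums above the window with the recursion `2^{5(k-1)/2}(∑|α_{·,(0,0,1)}|) q_{k-1}² ≤ ρ_k`, base link
`2Φ_{i,n-1} ≤ q_{kLo+n-1}²`, per-coordinate properness `|x_{ij}| ≤ Mw_{ij}` on `{v ≤ 0}`, re-entry decay `q_{k+1} ≤ 2^{-θ} r_k`; per-shell caps and TAIL RATE below the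
window), the description `P′(S,F) := v(win S) ≤ 0 ∧ 0 < g(win S) ∧ F ≥ 0 ∧ (∀ k < kLo, F_{·,k} ≤ r_k²/2)
∧ (∀ k ≥ kLo+n, tail sums above k ≤ r_k²/2) ∧ (∃ D, S = F = 0 below kLo - D) ∧ (∃ B, F ≤ B)` holds at
the rescaled one-shell datum, and every `(η, η)`-pseudo-flow from a `P′`-state with admissible slack on
a horizon `τ ≥ c` admits a checkpoint step: `RobustStep 1 θ c η i₀ α P′ env`.
[cite: Tao2016AveragedNS, §6.4 Prop. 6.5 (statement shape) with §4 Lemma 4.1 (4.5), (4.8)–(4.11);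
doi:10.1137/050645178 Thm 3.5 and §3.4 (eventuality certificates, robust form)] -/
theorem barrierSoundness₃ : ∀ (R θ c η γ : ℝ) (i₀ : Fin 4) (α : Fin 4 → Fin 4 → Fin 4 → ℤ × ℤ × ℤ → ℝ) (X₀ : Fin 4 → ℝ) (n : ℕ) (kLo : ℤ) (v g : (Fin 4 → Fin n → ℝ) → ℝ) (r q ρ env Ψ : ℤ → ℝ) (Mw Φ : Fin 4 → Fin n → ℝ) (win : (Fin 4 → ℤ → ℝ) → (Fin 4 → Fin n → ℝ)) (vf : (Fin 4 → ℤ → ℝ) → (Fin 4 → ℤ → ℝ)), 1 ≤ R ∧ Literature.Analysis.FluidPDE.TaoCascade.InTableClass R α ∧ X₀ i₀ ≠ 0 ∧ 0 ≤ θ ∧ θ ≤ 1 / 2 ∧ 0 < c ∧ 0 < η ∧ 0 < γ ∧ kLo ≤ 0 ∧ (2 : ℤ) ≤ kLo + n ∧ (∀ (S : Fin 4 → ℤ → ℝ) (i : Fin 4) (j : Fin n), win S i j = S i (kLo + (j : ℕ))) ∧ (∀ (S : Fin 4 → ℤ → ℝ) (i : Fin 4) (k : ℤ), vf S i k = Literature.Analysis.FluidPDE.TaoCascade.quadTerm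 1 α (fun i' k' (_ : ℝ) => S i' k') i k 0) ∧ ContDiff ℝ 1 v ∧ Continuous g ∧ (∀ (L' : ℕ) (k : ℤ), Literature.Analysis.FluidPDE.TaoCascade.slackWeight 1 θ c env L' k ≤ Ψ k) ∧ (∀ k : ℤ, 0 ≤ r k ∧ r k < q k ∧ 0 ≤ ρ k ∧ r k + c * ρ k ≤ q k ∧ q k ^ 2 / 2 ≤ env k) ∧ (∀ k : ℤ, kLo + n ≤ k → (1 + 1 : ℝ) ^ ((5 : ℝ) * ((k - 1 : ℤ) : ℝ) / 2) * (∑ i₁ : Fin 4, ∑ i₂ : Fin 4, ∑ i₃ : Fin 4, |α i₁ i₂ i₃ (0, 0, 1)|) * q (k - 1) ^ 2 ≤ ρ k) ∧ (∀ (i : Fin 4) (j : Fin n), (j : ℕ) + 1 = n → 2 * Φ i j ≤ q (kLo + (j : ℕ)) ^ 2) ∧ (∀ k : ℤ, kLo + n ≤ k → q (k + 1) ≤ (1 + 1 : ℝ) ^ (-θ) * r k) ∧ (∀ (i : Fin 4) (j : Fin n), 0 ≤ Φ i j ∧ Φ i j ≤ env (kLo + (j : ℕ)) ∧ Mw i j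 ^ 2 / 2 + η * Ψ (kLo + (j : ℕ)) + η * (1 + 1 : ℝ) ^ ((2 : ℝ) * ((kLo + (j : ℕ) : ℤ) : ℝ)) * c * Φ i j < Φ i j) ∧ (∃ M₁ : ℝ, ∀ k : ℤ, kLo + n ≤ k → (1 + (1 + 1 : ℝ) ^ ((10 : ℝ) * (k : ℝ))) * q k ≤ M₁) ∧ v (win (Literature.Analysis.FluidPDE.TaoCascade.datumState i₀ X₀)) ≤ 0 ∧ 0 < g (win (Literature.Analysis.FluidPDE.TaoCascade.datumState i₀ X₀)) ∧ (∀ x : Fin 4 → Fin n → ℝ, v x ≤ 0 → ∀ i j, |x i j| ≤ Mw i j) ∧ (∀ x : Fin 4 → Fin n → ℝ, v x ≤ 0 → 0 < g x → -(γ * c) < v x) ∧ (∀ (S F : Fin 4 → ℤ → ℝ) (d : Fin 4 → Fin n → ℝ), (v (win S) ≤ 0 ∧ (∀ i k, S i k ^ 2 ≤ 2 * F i k) ∧ (∀ i k, 0 ≤ F i k) ∧ (∀ i k, (k < kLo ∨ kLo + n ≤ k) → F i k ≤ q k ^ 2 / 2) ∧ (∀ (i : Fin 4) (j : Fin n), F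 i (kLo + (j : ℕ)) ≤ Φ i j)) → 0 < g (win S) → (∀ (i : Fin 4) (j : Fin n), |d i j| ≤ η * (1 + 1 : ℝ) ^ ((2 : ℝ) * ((kLo + (j : ℕ) : ℤ) : ℝ)) * Real.sqrt (Φ i j)) → (fderiv ℝ v (win S)) (fun i j => vf S i (kLo + (j : ℕ)) + d i j) ≤ -γ) ∧ (∀ (S F : Fin 4 → ℤ → ℝ), (v (win S) ≤ 0 ∧ (∀ i k, S i k ^ 2 ≤ 2 * F i k) ∧ (∀ i k, 0 ≤ F i k) ∧ (∀ i k, (k < kLo ∨ kLo + n ≤ k) → F i k ≤ q k ^ 2 / 2) ∧ (∀ (i : Fin 4) (j : Fin n), F i (kLo + (j : ℕ)) ≤ Φ i j)) → ∀ (i : Fin 4) (k : ℤ), k < kLo → vf S i k * S i k ≤ ρ k * |S i k|) ∧ (∀ (S F : Fin 4 → ℤ → ℝ), (v (win S) ≤ 0 ∧ (∀ i k, S i k ^ 2 ≤ 2 * F i k) ∧ (∀ i k, 0 ≤ F i k) ∧ (∀ i k, (k < kLo ∨ kLo + n ≤ k) → F i k ≤ q k ^ 2 / 2) ∧ (∀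 (i : Fin 4) (j : Fin n), F i (kLo + (j : ℕ)) ≤ Φ i j)) → g (win S) ≤ 0 → (1 + 1 : ℝ) ^ (-θ) ≤ |S i₀ 1| ∧ v (win (fun i k => S i (1 + k) / |S i₀ 1|)) ≤ 0 ∧ 0 < g (win (fun i k => S i (1 + k) / |S i₀ 1|)) ∧ (∀ i k, k < kLo → F i (1 + k) / |S i₀ 1| ^ 2 ≤ r k ^ 2 / 2)) → (fun S F => v (win S) ≤ 0 ∧ 0 < g (win S) ∧ (∀ i k, 0 ≤ F i k) ∧ (∀ i k, k < kLo → F i k ≤ r k ^ 2 / 2) ∧ (∀ k : ℤ, kLo + n ≤ k → ∀ L : ℕ, ∑ j ∈ Finset.range L, ∑ i, F i (k + j) ≤ r k ^ 2 / 2) ∧ (∃ D : ℕ, ∀ i k, k + D < kLo → S i k = 0 ∧ F i k = 0) ∧ ∃ B : ℝ, ∀ i k, F i k ≤ B) (Literature.Analysis.FluidPDE.TaoCascade.datumState i₀ X₀) (Literature.Analysis.FluidPDE.TaoCascade.datumEnergy i₀ X₀) ∧ Literature.Analysis.FluidPDE.TaoCascade.RobustStep 1 θ c η i₀ α (fun S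 F => v (win S) ≤ 0 ∧ 0 < g (win S) ∧ (∀ i k, 0 ≤ F i k) ∧ (∀ i k, k < kLo → F i k ≤ r k ^ 2 / 2) ∧ (∀ k : ℤ, kLo + n ≤ k → ∀ L : ℕ, ∑ j ∈ Finset.range L, ∑ i, F i (k + j) ≤ r k ^ 2 / 2) ∧ (∃ D : ℕ, ∀ i k, k + D < kLo → S i k = 0 ∧ F i k = 0) ∧ ∃ B : ℝ, ∀ i k, F i k ≤ B) env := by
  intro R θ c η γ i₀ α X₀ n kLo v g r q ρ env Ψ Mw Φ win vf hcl
  obtain ⟨hR, hα, hX₀, hθ0, hθ, hc, hη, hγ, hkLo, hkn, hwin, hvf, hv, hg, hΨ, hprof, hup, hΦq,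
    hdecay, hΦ, hM₁, hv0, hg0, hproper, hfloor, hdec, htail, hgoal⟩ := hcl
  have hαc : IsCancellingCoeff α := hα.2.1
  refine ⟨?_, ?_⟩
  · refine ⟨hv0, hg0, ?_, ?_, ?_, ⟨0, ?_⟩, ?_⟩
    · intro i k
      rw [datumEnergy_apply]
      split_ifs <;> positivity
    · intro i k hk
      have hk0 : k ≠ 0 := by omega
      rw [datumEnergy_apply, if_neg hk0, zero_div]
      have := (hprof k).1
      positivity
    · intro k hk L
      have hzero : ∑ j ∈ Finset.range L, ∑ i, datumEnergy i₀ X₀ i (k + j) = 0 :=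
        Finset.sum_eq_zero fun j _ => Finset.sum_eq_zero fun i _ => by
          rw [datumEnergy_apply, if_neg (by omega), zero_div]
      rw [hzero]
      have := (hprof k).1
      positivity
    · intro i k hk
      have hk0 : k ≠ 0 := by push_cast at hk; omega
      exact ⟨by rw [datumState_apply, if_neg hk0, zero_div],
        by rw [datumEnergy_apply, if_neg hk0, zero_div]⟩
    · refine ⟨(∑ i, (1 / 2) * X₀ i ^ 2) / |X₀ i₀| ^ 2, fun i k => ?_⟩
      rw [datumEnergy_apply]
      have hsum : (1 / 2) * X₀ i ^ 2 ≤ ∑ j, (1 / 2) * X₀ j ^ 2 :=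
        Finset.single_le_sum (f := fun j => (1 / 2) * X₀ j ^ 2) (fun j _ => by positivity)
          (Finset.mem_univ i)
      split_ifs
      · exact div_le_div_of_nonneg_right hsum (by positivity)
      · rw [zero_div]
        positivity
  · intro Lp S₀ F₀ B₀ hP hB τ hτc S F hflow
    obtain ⟨hPv, hPg, hPF0, hPlow, hPup, ⟨D, hPD⟩, ⟨Bb, hPB⟩⟩ := hP
    have hτ : 0 < τ := lt_of_lt_of_le hc hτc
    have hcτ : c ≤ τ := hτc
    have hSw : ∀ u, win (fun i k => S i k u) = fun i (j : Fin n) => S i (kLo + (j : ℕ)) u :=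
      fun u => funext fun i => funext fun j => hwin _ i j
    have hS0w : (fun i (j : Fin n) => S i (kLo + (j : ℕ)) 0) = win S₀ := by
      funext i j
      rw [hwin, hflow.init_S]
    -- the empty block of low shells stays empty
    have hZ := pseudoFlowOn_lower_block_zero hflow one_pos hαc (kLo - D - 1)
      (fun i k hk => (hPD i k (by omega)).2)
    have hSc : ∀ i k, ContinuousOn (S i k) (Icc 0 τ) := fun i k => (hflow.contDiffOn_S i k).continuousOn
    have hFc : ∀ i k, ContinuousOn (F i k) (Icc 0 τ) := fun i k => (hflow.contDiffOn_F i k).continuousOn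
    have hWc : ContinuousOn (fun u => (fun i (j : Fin n) => S i (kLo + (j : ℕ)) u)) (Icc 0 τ) :=
      continuousOn_pi.2 fun i => continuousOn_pi.2 fun j => hSc i _
    have hVc : ContinuousOn (fun u => v (fun i (j : Fin n) => S i (kLo + (j : ℕ)) u)) (Icc 0 τ) :=
      hv.continuous.comp_continuousOn hWc
    have hGc : ContinuousOn (fun u => g (fun i (j : Fin n) => S i (kLo + (j : ℕ)) u)) (Icc 0 τ) :=
      hg.comp_continuousOn hWc
    have hq_pos : ∀ k, 0 < q k := fun k => lt_of_le_of_lt (hprof k).1 (hprof k).2.1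
    -- the weak (closed) region constraints at time u
    set Rg : ℝ → Prop := fun u => v (fun i (j : Fin n) => S i (kLo + (j : ℕ)) u) ≤ 0 ∧
      (∀ (i : Fin 4) (j : Fin n), F i (kLo + (j : ℕ)) u ≤ Φ i j) ∧
      (∀ (i : Fin 4) (k : ℤ), k < kLo → F i k u ≤ q k ^ 2 / 2) with hRg_def
    have hRg0 : Rg 0 := by
      refine ⟨?_, ?_, ?_⟩
      · rw [hS0w]; exact hPv
      · intro i j
        have hup0 := hflow.defect_upper i (kLo + (j : ℕ)) 0 ⟨le_rfl, hτ.le⟩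
        rw [intervalIntegral.integral_same, mul_zero, add_zero, hflow.init_F, hflow.init_S] at hup0
        have hM' : |S₀ i (kLo + (j : ℕ))| ≤ Mw i j := by
          have := hproper (win S₀) hPv i j
          rwa [hwin] at this
        have h1 : (1 / 2) * S₀ i (kLo + (j : ℕ)) ^ 2 ≤ Mw i j ^ 2 / 2 := by
          have := sq_le_sq' (abs_le.mp hM').1 (abs_le.mp hM').2
          linarith
        have h2 : B₀ i (kLo + (j : ℕ)) ≤ η * Ψ (kLo + (j : ℕ)) :=
          (hB i _).2.trans (mul_le_mul_of_nonneg_left (hΨ Lp _) hη.le)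
        obtain ⟨hΦ0, -, hΦlt⟩ := hΦ i j
        have h4 : Mw i j ^ 2 / 2 + η * Ψ (kLo + (j : ℕ)) < Φ i j :=
          lt_of_le_of_lt (le_add_of_nonneg_right (by positivity)) hΦlt
        rw [hflow.init_F]
        linarith
      · intro i k hk
        rw [hflow.init_F]
        obtain ⟨hr0, hrq, -, -, -⟩ := hprof k
        have := hPlow i k hk
        nlinarith
    have hfull : ∀ t, t ∈ Icc 0 τ → t ≤ c → (∀ u ∈ Icc 0 t, Rg u) → ∀ u ∈ Icc 0 t,
        (v (win (fun i k => S i k u)) ≤ 0 ∧ (∀ i k, (fun i k => S i k u) i k ^ 2 ≤ 2 * (fun i k => F i k u) i k) ∧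
          (∀ i k, 0 ≤ (fun i k => F i k u) i k) ∧
          (∀ i k, (k < kLo ∨ kLo + n ≤ k) → (fun i k => F i k u) i k ≤ q k ^ 2 / 2) ∧
          (∀ (i : Fin 4) (j : Fin n), (fun i k => F i k u) i (kLo + (j : ℕ)) ≤ Φ i j)) ∧
        (∀ k : ℤ, kLo + n ≤ k → ∀ L : ℕ, ∑ j ∈ Finset.range L, ∑ i, F i (k + j) u ≤ q k ^ 2 / 2) := by
      intro t ht htc hRt u hu
      have huτ : u ∈ Icc 0 τ := ⟨hu.1, hu.2.trans ht.2⟩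
      have hUp : ∀ k : ℤ, kLo + n ≤ k → ∀ L : ℕ, ∀ u ∈ Icc 0 t,
          ∑ j ∈ Finset.range L, ∑ i, F i (k + j) u ≤ q k ^ 2 / 2 := by
        refine upper_tail_of_window hflow hαc (c := c) (fun k hk => ⟨(hprof k).1, (hprof k).2.2.2.1, ?_⟩)
          (hq_pos _).le hPup ht htc ?_
        · simpa using hup k hk
        · intro u hu i
          have hn1 : 1 ≤ n := by omega
          set jt : Fin n := ⟨n - 1, by omega⟩ with hjt
          have hkj : kLo + n - 1 = kLo + ((jt : ℕ) : ℤ) := by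
            simp only [hjt]
            push_cast [Nat.cast_sub hn1]
            ring
          have h1 := (hRt u hu).2.1 i jt
          have h2 := hΦq i jt (by simp only [hjt]; omega)
          rw [hkj]
          linarith
      refine ⟨⟨?_, fun i k => ?_, fun i k => hflow.nonneg_F i k u huτ, ?_, (hRt u hu).2.1⟩,
        fun k hk L => hUp k hk L u hu⟩
      · rw [hSw]; exact (hRt u hu).1
      · have := hflow.defect_lower i k u huτ
        simp only
        linarith
      · intro i k hk
        rcases hk with hk | hk
        · exact (hRt u hu).2.2 i k hk
        · have h1 := hUp k hk 1 u hu
          simp only [Finset.range_one, Finset.sum_singleton, Nat.cast_zero, add_zero] at h1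
          exact (Finset.single_le_sum (f := fun j => F j k u) (fun j _ => hflow.nonneg_F j k u huτ)
            (Finset.mem_univ i)).trans h1
    have hrate : ∀ t, t ∈ Icc 0 τ → t ≤ c → (∀ u ∈ Icc 0 t, Rg u) →
        (∀ u ∈ Icc 0 t, 0 < g (fun i (j : Fin n) => S i (kLo + (j : ℕ)) u)) →
        (∀ u ∈ Icc 0 t, (fderiv ℝ v (fun i (j : Fin n) => S i (kLo + (j : ℕ)) u))
            (fun i (j : Fin n) => derivWithin (S i (kLo + (j : ℕ))) (Icc 0 τ) u) ≤ -γ) ∧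
        (∀ u ∈ Icc 0 t, ∀ (i : Fin 4) (k : ℤ), k < kLo →
            derivWithin (F i k) (Icc 0 τ) u ≤ ρ k * Real.sqrt (2 * F i k u)) := by
      intro t ht htc hRt hGt
      refine ⟨fun u hu => ?_, fun u hu i k hk => ?_⟩
      · have huτ : u ∈ Icc 0 τ := ⟨hu.1, hu.2.trans ht.2⟩
        obtain ⟨hreg, -⟩ := hfull t ht htc hRt u hu
        exact clock_rate_of_clauses₃ hflow hη.le huτ hwin hvf hdec hreg (by rw [hSw]; exact hGt u hu)
      · have huτ : u ∈ Icc 0 τ := ⟨hu.1, hu.2.trans ht.2⟩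
        obtain ⟨hreg, -⟩ := hfull t ht htc hRt u hu
        exact lower_rate_of_clauses₃ hflow huτ hvf htail hreg hk (hprof k).2.2.1
    have hstrong : ∀ t, t ∈ Icc 0 τ → t ≤ c → (∀ u ∈ Icc 0 t, Rg u) →
        (∀ u ∈ Icc 0 t, 0 < g (fun i (j : Fin n) => S i (kLo + (j : ℕ)) u)) →
        (∀ s ∈ Icc 0 t, v (fun i (j : Fin n) => S i (kLo + (j : ℕ)) s) ≤ -(γ * s)) ∧
        (t < c → ∀ s ∈ Icc 0 t, ∀ (i : Fin 4) (k : ℤ), k < kLo → F i k s < q k ^ 2 / 2) ∧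
        (∀ s ∈ Icc 0 t, ∀ (i : Fin 4) (j : Fin n), F i (kLo + (j : ℕ)) s < Φ i j) := by
      intro t ht htc hRt hGt
      obtain ⟨hV', hF'⟩ := hrate t ht htc hRt hGt
      refine ⟨fun s hs => ?_, fun htc' s hs i k hk => ?_, fun s hs i j => ?_⟩
      · have h1 := clock_le_of_rate hflow hv kLo ht.2 hV' s hs
        have h0 := (hRt 0 ⟨le_rfl, ht.1⟩).1
        linarith
      · by_cases hkz : k ≤ kLo - D - 1
        · rw [(hZ s ⟨hs.1, hs.2.trans ht.2⟩ i k hkz).1]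
          have := hq_pos k
          positivity
        · exact lower_cap_lt hflow hτ ⟨(hprof k).1, (hprof k).2.1, (hprof k).2.2.1, (hprof k).2.2.2.1⟩
            (hPlow i k hk) ht.2 htc' (fun u hu => hF' u hu i k hk) hs
      · have hsτ : s ∈ Icc 0 τ := ⟨hs.1, hs.2.trans ht.2⟩
        have hM' : |S i (kLo + (j : ℕ)) s| ≤ Mw i j := hproper _ (hRt s hs).1 i j
        exact window_cap_lt (Φ := fun j' => Φ i j') hflow hη hB hΨ (hΦ i j).1 (hΦ i j).2.2 hsτ
          (hs.2.trans htc) hM' (fun u hu => (hRt u ⟨hu.1, hu.2.trans hs.2⟩).2.1 i j)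
    have hboot : ∀ t₀, t₀ ∈ Icc 0 τ → t₀ ≤ c →
        (∀ u ∈ Ico 0 t₀, 0 < g (fun i (j : Fin n) => S i (kLo + (j : ℕ)) u)) →
        ∀ u ∈ Icc 0 t₀, Rg u := by
      intro t₀ ht₀ ht₀c hG
      -- the constraint set, closed by construction
      set T : Set ℝ := Icc 0 t₀ ∩
        ((Icc 0 t₀ ∩ (fun u => v (fun i (j : Fin n) => S i (kLo + (j : ℕ)) u)) ⁻¹' Iic 0) ∩
         ((⋂ (i : Fin 4), ⋂ (j : Fin n), Icc 0 t₀ ∩ (F i (kLo + (j : ℕ))) ⁻¹' Iic (Φ i j)) ∩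
          (⋂ (i : Fin 4), ⋂ (k : ℤ), ⋂ (_ : k < kLo), Icc 0 t₀ ∩ (F i k) ⁻¹' Iic (q k ^ 2 / 2))))
        with hT
      have hsubτ : Icc 0 t₀ ⊆ Icc 0 τ := Icc_subset_Icc_right ht₀.2
      have hTclosed : IsClosed T := by
        refine isClosed_Icc.inter (IsClosed.inter ?_ (IsClosed.inter ?_ ?_))
        · exact (hVc.mono hsubτ).preimage_isClosed_of_isClosed isClosed_Icc isClosed_Iic
        · exact isClosed_iInter fun i => isClosed_iInter fun j =>
            ((hFc i _).mono hsubτ).preimage_isClosed_of_isClosed isClosed_Icc isClosed_Iic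
        · exact isClosed_iInter fun i => isClosed_iInter fun k => isClosed_iInter fun _ =>
            ((hFc i k).mono hsubτ).preimage_isClosed_of_isClosed isClosed_Icc isClosed_Iic
      -- membership in T
      have hTmem : ∀ u, u ∈ T ↔ u ∈ Icc 0 t₀ ∧ Rg u := by
        intro u
        simp only [hT, hRg_def, mem_inter_iff, mem_iInter, mem_preimage, mem_Iic]
        constructor
        · rintro ⟨hI, ⟨-, hv'⟩, hw, hl⟩
          exact ⟨hI, hv', fun i j => (hw i j).2, fun i k hk => (hl i k hk).2⟩
        · rintro ⟨hI, hv', hw, hl⟩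
          exact ⟨hI, ⟨hI, hv'⟩, fun i j => ⟨hI, hw i j⟩, fun i k hk => ⟨hI, hl i k hk⟩⟩
      have hcover : Icc 0 t₀ ⊆ T := by
        apply (show IsClosed (T ∩ Icc 0 t₀) from hTclosed.inter isClosed_Icc).Icc_subset_of_forall_mem_nhdsGT_of_Icc_subset
        · exact (hTmem 0).2 ⟨⟨le_rfl, ht₀.1⟩, hRg0⟩
        · intro x hx hxT
          have hRx : ∀ u ∈ Icc 0 x, Rg u := fun u hu => ((hTmem u).1 (hxT hu)).2
          have hxτ : x < τ := lt_of_lt_of_le hx.2 (ht₀c.trans hcτ)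
          have hxc : x < c := lt_of_lt_of_le hx.2 ht₀c
          have hxI : x ∈ Icc 0 τ := ⟨hx.1, hxτ.le⟩
          have hGx : ∀ u ∈ Icc 0 x, 0 < g (fun i (j : Fin n) => S i (kLo + (j : ℕ)) u) :=
            fun u hu => hG u ⟨hu.1, lt_of_le_of_lt hu.2 hx.2⟩
          obtain ⟨-, hLs, hWs⟩ := hstrong x hxI hxc.le hRx hGx
          obtain ⟨hV', -⟩ := hrate x hxI hxc.le hRx hGx
          have hfil : 𝓝[>] x ≤ 𝓝[Icc 0 τ] x := by
            rw [← nhdsWithin_Ioo_eq_nhdsGT hxτ]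
            exact nhdsWithin_mono _ fun u hu => ⟨hx.1.trans hu.1.le, hu.2.le⟩
          have e1 : ∀ᶠ u in 𝓝[>] x, u ∈ Ioo x t₀ := Ioo_mem_nhdsGT hx.2
          obtain ⟨δ, hδ, hVlt⟩ :=
            clock_lt_right_of_rate_neg hflow hv kLo hγ hxI (hV' x ⟨hx.1, le_rfl⟩)
          have e2 : ∀ᶠ u in 𝓝[>] x, u ∈ Ioo x (x + δ) := Ioo_mem_nhdsGT (by linarith)
          have e3 : ∀ᶠ u in 𝓝[>] x, ∀ (i : Fin 4) (j : Fin n), F i (kLo + (j : ℕ)) u < Φ i j := by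
            refine Filter.eventually_all.2 fun i => Filter.eventually_all.2 fun j => ?_
            exact hfil ((hFc i _ x hxI).eventually_lt_const (hWs x ⟨hx.1, le_rfl⟩ i j))
          have e4 : ∀ᶠ u in 𝓝[>] x, ∀ (i : Fin 4), ∀ k ∈ Finset.Ico (kLo - D) kLo,
              F i k u < q k ^ 2 / 2 := by
            refine Filter.eventually_all.2 fun i => (Finset.Ico (kLo - D) kLo).eventually_all.2 fun k hk => ?_
            have hk' : k < kLo := (Finset.mem_Ico.mp hk).2
            exact hfil ((hFc i k x hxI).eventually_lt_const (hLs hxc x ⟨hx.1, le_rfl⟩ i k hk'))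
          filter_upwards [e1, e2, e3, e4] with u hu1 hu2 hu3 hu4
          have huI : u ∈ Icc 0 τ := ⟨hx.1.trans hu1.1.le, (hu1.2.le.trans ht₀.2)⟩
          refine (hTmem u).2 ⟨⟨huI.1, hu1.2.le⟩, ?_, fun i j => (hu3 i j).le, fun i k hk => ?_⟩
          · have h1 := hVlt u huI hu2.1 hu2.2
            have h2 := (hRx x ⟨hx.1, le_rfl⟩).1
            linarith
          · by_cases hkz : k ≤ kLo - D - 1
            · rw [(hZ u huI i k hkz).1]
              have := hq_pos k
              positivity
            · exact (hu4 i k (Finset.mem_Ico.mpr ⟨by omega, hk⟩)).le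
      intro u hu
      exact ((hTmem u).1 (hcover hu)).2
    set Gs : Set ℝ := Icc 0 c ∩ (fun u => g (fun i (j : Fin n) => S i (kLo + (j : ℕ)) u)) ⁻¹' Iic 0
      with hGs
    have hGs_closed : IsClosed Gs :=
      (hGc.mono (Icc_subset_Icc_right hcτ)).preimage_isClosed_of_isClosed isClosed_Icc isClosed_Iic
    have hcI : c ∈ Icc 0 τ := ⟨hc.le, hcτ⟩
    have hGs_ne : Gs.Nonempty := by
      by_contra hne
      rw [Set.not_nonempty_iff_eq_empty] at hne
      have hGpos : ∀ u ∈ Icc 0 c, 0 < g (fun i (j : Fin n) => S i (kLo + (j : ℕ)) u) := by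
        intro u hu
        by_contra hle
        push Not at hle
        have : u ∈ Gs := ⟨hu, hle⟩
        rw [hne] at this
        exact this
      have hRc := hboot c hcI le_rfl fun u hu => hGpos u ⟨hu.1, hu.2.le⟩
      obtain ⟨hVs, -, -⟩ := hstrong c hcI le_rfl hRc hGpos
      have h1 := hVs c ⟨hc.le, le_rfl⟩
      have h2 := hfloor _ (hRc c ⟨hc.le, le_rfl⟩).1 (hGpos c ⟨hc.le, le_rfl⟩)
      linarith
    have hGs_bdd : BddBelow Gs := ⟨0, fun u hu => hu.1.1⟩
    set τ₁ : ℝ := sInf Gs with hτ₁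
    have hτ₁mem : τ₁ ∈ Gs := hGs_closed.csInf_mem hGs_ne hGs_bdd
    have hτ₁le : ∀ u ∈ Gs, τ₁ ≤ u := fun u hu => csInf_le hGs_bdd hu
    obtain ⟨⟨hτ₁0, hτ₁c⟩, hgτ₁⟩ := hτ₁mem
    simp only [mem_preimage, mem_Iic] at hgτ₁
    have hGpos : ∀ u ∈ Ico 0 τ₁, 0 < g (fun i (j : Fin n) => S i (kLo + (j : ℕ)) u) := by
      intro u hu
      by_contra hle
      push Not at hle
      have hmem : u ∈ Gs := ⟨⟨hu.1, hu.2.le.trans hτ₁c⟩, hle⟩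
      exact absurd (hτ₁le u hmem) (not_le.mpr hu.2)
    have hτ₁pos : 0 < τ₁ := by
      rcases hτ₁0.eq_or_lt with h | h
      · exfalso
        have h0 : 0 < g (fun i (j : Fin n) => S i (kLo + (j : ℕ)) 0) := by rw [hS0w]; exact hPg
        rw [← h] at hgτ₁
        linarith
      · exact h
    have hτ₁I : τ₁ ∈ Icc 0 τ := ⟨hτ₁0, hτ₁c.trans hcτ⟩
    have hR := hboot τ₁ hτ₁I hτ₁c hGpos
    obtain ⟨hreg, hUp⟩ := hfull τ₁ hτ₁I hτ₁c hR τ₁ ⟨hτ₁0, le_rfl⟩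
    have hG := hgoal (fun i k => S i k τ₁) (fun i k => F i k τ₁) hreg (by rw [hSw]; exact hgτ₁)
    obtain ⟨ha, hvnew, hgnew, hlownew⟩ := hG
    have h2θ : 0 < (1 + 1 : ℝ) ^ (-θ) := Real.rpow_pos_of_pos (by norm_num) _
    have ha_pos : 0 < |S i₀ 1 τ₁| := lt_of_lt_of_le h2θ ha
    refine ⟨τ₁, |S i₀ 1 τ₁|, hτ₁pos, hτ₁c, ha_pos, ha, le_rfl, ?_, ?_⟩
    · refine ⟨hvnew, hgnew, ?_, ?_, ?_, ⟨D + 1, ?_⟩, ?_⟩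
      · intro i k
        exact div_nonneg (hflow.nonneg_F i (1 + k) τ₁ hτ₁I) (sq_nonneg _)
      · intro i k hk
        exact hlownew i k hk
      · intro k hk L
        have h1 : ∑ j ∈ Finset.range L, ∑ i, F i (1 + (k + j)) τ₁ / |S i₀ 1 τ₁| ^ 2 =
            (∑ j ∈ Finset.range L, ∑ i, F i ((k + 1) + j) τ₁) / |S i₀ 1 τ₁| ^ 2 := by
          rw [Finset.sum_div]
          refine Finset.sum_congr rfl fun j _ => ?_
          rw [Finset.sum_div]
          refine Finset.sum_congr rfl fun i _ => ?_
          ring_nf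
        have h2 := hUp (k + 1) (by linarith) L
        have h3 := hdecay k hk
        have hq0 : 0 ≤ q (k + 1) := (hq_pos _).le
        have h4 : q (k + 1) ≤ |S i₀ 1 τ₁| * r k :=
          h3.trans (mul_le_mul_of_nonneg_right ha (hprof k).1)
        have h5 : q (k + 1) ^ 2 ≤ |S i₀ 1 τ₁| ^ 2 * r k ^ 2 := by
          rw [← mul_pow]
          exact pow_le_pow_left₀ hq0 h4 2
        rw [h1, div_le_iff₀ (by positivity)]
        nlinarith
      · intro i k hk
        have hk' : 1 + k ≤ kLo - D - 1 := by push_cast at hk; omega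
        obtain ⟨hF0, hS0⟩ := hZ τ₁ hτ₁I i (1 + k) hk'
        simp [hF0, hS0]
      · obtain ⟨MF, hMF⟩ := hflow.apriori_F
        refine ⟨MF ^ 2 / |S i₀ 1 τ₁| ^ 2, fun i k => ?_⟩
        have h1 := hMF τ₁ hτ₁I i (1 + k)
        have hw : 0 ≤ (1 + 1 : ℝ) ^ ((10 : ℝ) * ((1 + k : ℤ) : ℝ)) :=
          (Real.rpow_pos_of_pos (by norm_num) _).le
        have hsq0 : 0 ≤ Real.sqrt (F i (1 + k) τ₁) := Real.sqrt_nonneg _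
        have hsF : Real.sqrt (F i (1 + k) τ₁) ≤ MF := by
          have := mul_nonneg hw hsq0
          nlinarith
        have hF : F i (1 + k) τ₁ ≤ MF ^ 2 := by
          have e := Real.sq_sqrt (hflow.nonneg_F i (1 + k) τ₁ hτ₁I)
          rw [← e]
          exact pow_le_pow_left₀ hsq0 hsF 2
        exact div_le_div_of_nonneg_right hF (sq_nonneg _)
    · intro s hs i k
      have hsI : s ∈ Icc 0 τ := ⟨hs.1, hs.2.trans hτ₁I.2⟩
      obtain ⟨hreg_s, -⟩ := hfull τ₁ hτ₁I hτ₁c hR s hs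
      rcases lt_or_ge k kLo with hk | hk
      · exact ((hR s hs).2.2 i k hk).trans (hprof k).2.2.2.2
      · rcases lt_or_ge k (kLo + n) with hk2 | hk2
        · set j : Fin n := ⟨(k - kLo).toNat, by omega⟩ with hj
          have hkj : kLo + ((j : ℕ) : ℤ) = k := by
            simp only [hj, Int.toNat_of_nonneg (show 0 ≤ k - kLo by omega)]
            ring
          have h1 := (hR s hs).2.1 i j
          have h2 := (hΦ i j).2.1
          rw [hkj] at h1 h2
          exact h1.trans h2
        · have h1 := hreg_s.2.2.2.1 i k (Or.inr hk2)
          simp only at h1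
          exact h1.trans (hprof k).2.2.2.2

end BarrierSoundness

end Summit.NavierStokesRegularity.NavierStokesRegularity.Theorems

end

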